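import Literature.Topology.FourManifolds.UnknotFlatChart
import Literature.Topology.FourManifolds.RadialDiffeomorph
import HarnessLib

/-!
# Surgery on a split link: the transplant map from the unknot model to a flattened knot

Infrastructure (theorems only) for the connected-sum decomposition of surgery on a split link
(`Literature.Topology.FourManifolds.exists_isSurgery_zeroFramedUnlink`, `KirbyCalculus.lean`).
Let `Γ : ℝ³ → 𝕊 3` be a flattening chart of a knot `K` defined on all of `ℝ³` (`Knot.FlatChart`
with `Ω = univ`) and let `(N, S₀)` be the pole and the isometry of the global flattening chart of
the unknot (`exists_flatChart_unknot`: `σ_N⁻¹ (S₀ (2 • flatCircle u)) = unknot u`). The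
**transplant map**

  `μ a = Γ (16 • g (S₀⁻¹ (σ_N (R_N a))))`,

`g` the ball contraction of `RadialDiffeomorph.lean` (linear, `= (1/32) •`, on the ball of
radius `8`), `R_N` the reflection in `Nᗮ`, is the map `𝕊 3 ∖ {-N} → Γ (B(0, 16))` through which
the punctured sphere enters the standard model `X # Sⁿ ≅ X` (`ConnectedSumSphereData.β`,
`ConnectedSumSphereIdentity.lean`), read in `𝕊 3` instead of `X`. This file records its
elementary properties: it is a smooth injective map of `𝕊 3 ∖ (unknot ∪ {-N})` with smooth
inverse on its open image, it carries no point off the unknot onto `K`, every point `Γ v`,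
`‖v‖ ≤ 2`, off `K` is in its image, and `μ (R_N (σ_N⁻¹ (S₀ (2 • y)))) = Γ y` for `‖y‖ < 4` — so
that `μ` matches the flat tubular neighbourhoods of the unknot and of `K` built from the same
flat data (`exists_transplantMap`). Also: the flat tube lies in the ball of radius `2`
(`BlowDownFlat.norm_flatTubeS_lt_two`).

## References

* M. A. Kervaire, J. W. Milnor, *Groups of homotopy spheres: I*, Ann. of Math. 77 (1963), §2.
* A. Kosinski, *Differential Manifolds* (1993), VI.1.3.
-/

open scoped Manifold ContDiff Topology RealInnerProductSpace
open Set Function Metric Module Filter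

noncomputable section

namespace Literature.Topology.FourManifolds

/-- Local notation: `𝔼 n` is the model Euclidean space `EuclideanSpace ℝ (Fin n)`. -/
local notation "𝔼 " n:arg => EuclideanSpace ℝ (Fin n)

/-- Local notation: `𝕊 n` is the unit sphere in `EuclideanSpace ℝ (Fin (n + 1))`. -/
local notation "𝕊 " n:arg => (Metric.sphere (0 : EuclideanSpace ℝ (Fin (n + 1))) 1)

attribute [local instance] fact_finrank_euclideanSpace_two fact_finrank_euclideanSpace_four

open BlowDownFlat

/-! ### The flat tube lies in the ball of radius `2` -/

/-- **The flat tube lies in the ball of radius `2`**: `‖flatTubeS h δ q‖ < 2` (its transverse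
coordinates `(a, z)` have norm `< δ ≤ 1/4`, and `x² + y² = 1 + 2a`). [folklore] -/
theorem BlowDownFlat.norm_flatTubeS_lt_two {h δ : ℝ} (hh : h ^ 2 = 1) (hδ : 0 < δ) (hδ4 : δ ≤ 1 / 4)
    (q : (𝕊 1) × 𝔼 2) : ‖flatTubeS h δ q‖ < 2 := by
  set p := flatTubeS h δ q with hp
  have haz : ‖az p‖ < δ := by
    rw [hp, flatTubeS_apply, norm_az_flatTube hh hδ hδ4]; exact norm_squeeze_lt hδ _
  have ha : |aFun p| < δ := (abs_apply_le_norm_two (az p) 0).trans_lt haz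
  have hz : |p 2| < δ := (abs_apply_le_norm_two (az p) 1).trans_lt haz
  have h1 : ‖p‖ ^ 2 = ‖xy p‖ ^ 2 + p 2 ^ 2 := by rw [norm_sq_eq_three, ← sq_add_sq_eq_norm_xy_sq]
  have h2 := norm_xy_sq p
  have h3 : ‖p‖ ^ 2 < 4 := by
    rw [h1, h2]
    have := abs_lt.1 ha
    have hz2 : p 2 ^ 2 < δ ^ 2 := by
      rw [← sq_abs]; exact pow_lt_pow_left₀ hz (abs_nonneg _) two_ne_zero
    nlinarith
  nlinarith [norm_nonneg p]

/-! ### The transplant map -/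

/-- **The transplant map from the unknot model to a flattened knot.** Let `Φ₀` be a flattening
chart of the knot `K` with `Φ₀.Ω = univ`, and let `N : 𝕊 3`, `S₀ : ℝ³ ≃ₗᵢ ℝ³` satisfy
`σ_N⁻¹ (S₀ (2 • flatCircle u)) = unknot u` (`exists_flatChart_unknot`). With
`μ a = Φ₀.Γ (16 • g (S₀⁻¹ (σ_N (R_N a))))` (`g` the ball contraction, `R_N` the reflection in
`Nᗮ`, `σ_N` the stereographic projection from `N`) and the explicit inverse
`μinv p = R_N (σ_N⁻¹ (S₀ (g⁻¹ (16⁻¹ • Φ₀.inv p))))`: `μ` is smooth on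
`A = 𝕊 3 ∖ (unknot ∪ {-N})` with `μinv ∘ μ = id` there, `μinv` is smooth on the open image
`μ (A)`; a point `a ≠ -N` with `μ a ∈ K` lies on the unknot; every `Φ₀.Γ v` with `‖v‖ ≤ 2`,
`v` off the flat circle, is `μ a₀` for some `a₀ ∈ A`; and `μ (R_N (σ_N⁻¹ (S₀ (2 • y)))) = Φ₀.Γ y`
for `‖y‖ < 4` (where `g` is linear). [folklore] -/
theorem exists_transplantMap {K : Knot} (Φ₀ : K.FlatChart) (hΩ : Φ₀.Ω = univ) (N : 𝕊 3)
    (S₀ : 𝔼 3 ≃ₗᵢ[ℝ] 𝔼 3)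
    (hcircle : ∀ u : 𝕊 1, (stereographic' 3 N).symm (S₀ ((2 : ℝ) • flatCircle u)) = unknot u) :
    ∃ μ μinv : 𝕊 3 → 𝕊 3,
      (∀ a, μ a = Φ₀.Γ ((16 : ℝ) • ballContraction
        (S₀.symm (stereographic' 3 N (poleReflectionSphere (n := 3) N a))))) ∧
      ContMDiffOn (𝓡 3) (𝓡 3) ∞ μ {a | a ∉ range unknot ∧ a ≠ -N} ∧
      ContMDiffOn (𝓡 3) (𝓡 3) ∞ μinv (μ '' {a | a ∉ range unknot ∧ a ≠ -N}) ∧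
      IsOpen (μ '' {a | a ∉ range unknot ∧ a ≠ -N}) ∧
      (∀ a, a ∉ range unknot → a ≠ -N → μinv (μ a) = a) ∧
      (∀ a, a ≠ -N → μ a ∈ range K → a ∈ range unknot) ∧
      (∀ v : 𝔼 3, ‖v‖ ≤ 2 → v ∉ range flatCircle →
        ∃ a₀, a₀ ∉ range unknot ∧ a₀ ≠ -N ∧ μ a₀ = Φ₀.Γ v) ∧
      (∀ y : 𝔼 3, ‖y‖ < 4 →
        μ (poleReflectionSphere (n := 3) N ((stereographic' 3 N).symm (S₀ ((2 : ℝ) • y)))) =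
          Φ₀.Γ y) := by
  set σ := stereographic' 3 N with hσ
  set R := poleReflectionSphere (n := 3) N with hR
  set g : 𝔼 3 → 𝔼 3 := ballContraction with hg
  set ginv : 𝔼 3 → 𝔼 3 := ballContractionInv with hginv
  have hmemΩ : ∀ w, w ∈ Φ₀.Ω := fun w ↦ by rw [hΩ]; trivial
  -- the reflection exchanges `±N` and conjugates `σ_N⁻¹`
  have hRR : ∀ a, R (R a) = a := poleReflectionSphere_poleReflectionSphere (n := 3) N
  have hRneg : R (-N) = N := by
    have h := hRR N
    rwa [hR, poleReflectionSphere_pole] at h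
  have hRne : ∀ {a : 𝕊 3}, a ≠ -N → R a ≠ N := fun {a} ha h ↦ ha (by rw [← hRR a, h, hR,
    poleReflectionSphere_pole])
  have hsrc : ∀ {a : 𝕊 3}, a ≠ -N → R a ∈ σ.source := fun ha ↦ by
    rw [hσ, stereographic'_source]; exact hRne ha
  have hσσ : ∀ x : 𝔼 3, σ (σ.symm x) = x := fun x ↦ σ.right_inv (by rw [hσ, stereographic'_target]; trivial)
  have hσne : ∀ x : 𝔼 3, σ.symm x ≠ N := stereographic'_symm_ne N
  -- `R` fixes the unknot, which is `σ⁻¹ (S₀ (2 • flatCircle u))`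
  have hnfc : ∀ u : 𝕊 1, ‖flatCircle u‖ = 1 := fun u ↦ by
    have h := norm_sq_eq_three (flatCircle u)
    have h0 : flatCircle u 0 = (u : 𝔼 2) 0 := rfl
    have h1 : flatCircle u 1 = (u : 𝔼 2) 1 := rfl
    have h2 : flatCircle u 2 = 0 := rfl
    rw [h0, h1, h2, sphere_sq u] at h
    nlinarith [norm_nonneg (flatCircle u)]
  have hnorm2 : ∀ u : 𝕊 1, ‖S₀ ((2 : ℝ) • flatCircle u)‖ = 2 := fun u ↦ by
    rw [LinearIsometryEquiv.norm_map, norm_smul, hnfc, mul_one, Real.norm_eq_abs,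
      abs_of_pos two_pos]
  have hRfix : ∀ u : 𝕊 1, R (unknot u) = unknot u := fun u ↦ by
    rw [← hcircle u]
    have h0 : S₀ ((2 : ℝ) • flatCircle u) ≠ 0 := by
      rw [← norm_ne_zero_iff, hnorm2]; norm_num
    apply Subtype.ext
    rw [hR, LinearIsometryEquiv.coe_sphereDiffeomorph_apply, hσ,
      poleReflection_stereographic'_symm N h0, hnorm2]
    norm_num
  -- the maps
  set μ : 𝕊 3 → 𝕊 3 := fun a ↦ Φ₀.Γ ((16 : ℝ) • g (S₀.symm (σ (R a)))) with hμ
  set μinv : 𝕊 3 → 𝕊 3 := fun p ↦ R (σ.symm (S₀ (ginv ((16 : ℝ)⁻¹ • Φ₀.inv p)))) with hμinv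
  set A : Set (𝕊 3) := {a | a ∉ range unknot ∧ a ≠ -N} with hA
  have hAo : IsOpen A :=
    (unknot).isClosed_range.isOpen_compl.inter isOpen_compl_singleton
  -- left inverse
  have hleft : ∀ a, a ∉ range unknot → a ≠ -N → μinv (μ a) = a := by
    intro a _ ha
    simp only [hμ, hμinv]
    rw [Φ₀.inv_apply (hmemΩ _), smul_smul, inv_mul_cancel₀ (by norm_num : (16 : ℝ) ≠ 0), one_smul,
      hginv, hg, ballContractionInv_ballContraction, LinearIsometryEquiv.apply_symm_apply,
      σ.left_inv (hsrc ha), hRR]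
  -- smoothness of `μ`
  have hcs : ContMDiffOn (𝓡 3) (𝓡 3) ∞ (fun a : 𝕊 3 ↦ σ (R a)) {a | a ≠ -N} :=
    (contMDiffOn_stereographic' N).comp R.contMDiff.contMDiffOn fun a ha ↦ hRne ha
  have hμs : ContMDiffOn (𝓡 3) (𝓡 3) ∞ μ A := by
    have h1 : ContMDiffOn (𝓡 3) 𝓘(ℝ, 𝔼 3) ∞ (fun a : 𝕊 3 ↦ (16 : ℝ) • g (S₀.symm (σ (R a))))
        {a | a ≠ -N} := by
      refine ((contDiff_const_smul (16 : ℝ)).comp (contDiff_ballContraction.comp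
        S₀.symm.toContinuousLinearEquiv.contDiff)).contMDiff.comp_contMDiffOn hcs
    exact (Φ₀.contMDiffOn.comp h1 fun a _ ↦ hmemΩ _).mono fun a ha ↦ ha.2
  -- smoothness of `μinv` on the image
  have hμinvs : ContMDiffOn (𝓡 3) (𝓡 3) ∞ μinv (μ '' A) := by
    have h1 : ContMDiffOn (𝓡 3) 𝓘(ℝ, 𝔼 3) ∞ (fun p ↦ (16 : ℝ)⁻¹ • Φ₀.inv p) (μ '' A) := by
      refine ((contDiff_const_smul (16 : ℝ)⁻¹).contMDiff.comp_contMDiffOn Φ₀.contMDiffOn_inv).mono ?_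
      rintro _ ⟨a, -, rfl⟩
      exact ⟨_, hmemΩ _, rfl⟩
    have hmaps : MapsTo (fun p ↦ (16 : ℝ)⁻¹ • Φ₀.inv p) (μ '' A) (ball 0 1) := by
      rintro _ ⟨a, -, rfl⟩
      simp only [hμ]
      rw [Φ₀.inv_apply (hmemΩ _), smul_smul, inv_mul_cancel₀ (by norm_num : (16 : ℝ) ≠ 0), one_smul,
        mem_ball_zero_iff]
      exact norm_ballContraction_lt_one _
    have h2 : ContMDiffOn (𝓡 3) 𝓘(ℝ, 𝔼 3) ∞ (fun p ↦ ginv ((16 : ℝ)⁻¹ • Φ₀.inv p)) (μ '' A) :=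
      (contMDiffOn_iff_contDiffOn.2 contDiffOn_ballContractionInv).comp h1 hmaps
    have h3 : ContMDiffOn (𝓡 3) 𝓘(ℝ, 𝔼 3) ∞ (fun p ↦ S₀ (ginv ((16 : ℝ)⁻¹ • Φ₀.inv p))) (μ '' A) :=
      S₀.toContinuousLinearEquiv.contDiff.contMDiff.comp_contMDiffOn h2
    exact R.contMDiff.comp_contMDiffOn ((contMDiff_stereographic'_symm N).comp_contMDiffOn h3)
  -- openness of the image
  have hopen : IsOpen (μ '' A) := by
    have hs₁ : IsOpen (R '' A) := R.toHomeomorph.isOpenMap A hAo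
    have hs₁src : R '' A ⊆ σ.source := by
      rintro _ ⟨a, ha, rfl⟩; exact hsrc ha.2
    have hs₂ : IsOpen (σ '' (R '' A)) := σ.isOpen_image_of_subset_source hs₁ hs₁src
    have hs₃ : IsOpen (S₀.symm '' (σ '' (R '' A))) :=
      S₀.symm.toContinuousLinearEquiv.toHomeomorph.isOpenMap _ hs₂
    have hs₄ : IsOpen (g '' (S₀.symm '' (σ '' (R '' A)))) := by
      have := (ballContractionPartialHomeomorph (E := 𝔼 3)).isOpen_image_of_subset_source hs₃
        (by simp)
      simpa using this
    have hs₅ : IsOpen ((fun x : 𝔼 3 ↦ (16 : ℝ) • x) '' (g '' (S₀.symm '' (σ '' (R '' A))))) :=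
      (Homeomorph.smulOfNeZero (16 : ℝ) (by norm_num)).isOpenMap _ hs₄
    have hs₆ := Φ₀.isOpen_image hs₅ (fun w _ ↦ hmemΩ w)
    have heq : μ '' A =
        Φ₀.Γ '' ((fun x : 𝔼 3 ↦ (16 : ℝ) • x) '' (g '' (S₀.symm '' (σ '' (R '' A))))) := by
      simp only [image_image]
      rfl
    rw [heq]
    exact hs₆
  -- no point off the unknot is carried onto `K`
  have hK : ∀ a, a ≠ -N → μ a ∈ range K → a ∈ range unknot := by
    intro a ha hmem
    set x := S₀.symm (σ (R a)) with hx
    have hw : (16 : ℝ) • g x ∈ range flatCircle := Φ₀.mem_range_flatCircle_of_mem (hmemΩ _) hmem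
    obtain ⟨u, hu⟩ := hw
    have hnorm : ‖g x‖ = 16⁻¹ := by
      have h1 := congrArg norm hu
      rw [norm_smul, Real.norm_eq_abs, abs_of_pos (by norm_num : (0 : ℝ) < 16), hnfc] at h1
      linarith
    have hx2 : ‖x‖ = 2 := by
      rw [hg, norm_ballContraction] at hnorm
      have h2 : ballProfile 2 = 16⁻¹ := by rw [ballProfile_of_le (by norm_num)]; norm_num
      exact injective_ballProfile (hnorm.trans h2.symm)
    have hgx : g x = (32 : ℝ)⁻¹ • x := ballContraction_eq_smul_of_norm_lt (by rw [hx2]; norm_num)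
    have hx' : x = (2 : ℝ) • flatCircle u := by
      have h1 : (16 : ℝ) • ((32 : ℝ)⁻¹ • x) = flatCircle u := by rw [← hgx]; exact hu.symm
      rw [smul_smul] at h1
      have h2 : x = (2 : ℝ) • ((16 * (32 : ℝ)⁻¹) • x) := by rw [smul_smul]; norm_num
      rw [h2, h1]
    have hRa : R a = unknot u := by
      rw [← hcircle u, ← hx', hx, LinearIsometryEquiv.apply_symm_apply, σ.left_inv (hsrc ha)]
    exact ⟨u, by rw [← hRfix u, ← hRa, hRR]⟩
  -- every `Γ v`, `‖v‖ ≤ 2`, `v` off the flat circle, is in the image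
  have hcov : ∀ v : 𝔼 3, ‖v‖ ≤ 2 → v ∉ range flatCircle →
      ∃ a₀, a₀ ∉ range unknot ∧ a₀ ≠ -N ∧ μ a₀ = Φ₀.Γ v := by
    intro v hv hvc
    have hv16 : ‖(16 : ℝ)⁻¹ • v‖ < 1 := by
      rw [norm_smul, Real.norm_eq_abs, abs_of_pos (by norm_num : (0 : ℝ) < 16⁻¹)]; linarith
    set y₁ := σ.symm (S₀ (ginv ((16 : ℝ)⁻¹ • v))) with hy₁
    refine ⟨R y₁, ?_, fun h ↦ hσne _ (by rw [← hRneg, ← h, hRR]), ?_⟩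
    · rintro ⟨u, hu⟩
      have h1 : y₁ = unknot u := by rw [← hRR y₁, ← hu, hRfix]
      rw [← hcircle u, hy₁] at h1
      have h2 := S₀.injective (stereographic'_symm_injective_sphereThree N h1)
      have h3 : (16 : ℝ)⁻¹ • v = ballContraction ((2 : ℝ) • flatCircle u) := by
        rw [← h2]; exact (ballContraction_ballContractionInv hv16).symm
      have hn8 : ‖(2 : ℝ) • flatCircle u‖ < 8 := by
        rw [norm_smul, hnfc, mul_one, Real.norm_eq_abs, abs_of_pos two_pos]; norm_num
      rw [ballContraction_eq_smul_of_norm_lt hn8, smul_smul] at h3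
      have h4 : v = flatCircle u := by
        have h5 := congrArg (fun w : 𝔼 3 ↦ (16 : ℝ) • w) h3
        simp only [smul_smul] at h5
        norm_num at h5
        exact h5
      exact hvc ⟨u, h4.symm⟩
    · simp only [hμ]
      rw [hRR, hy₁, hσσ, LinearIsometryEquiv.symm_apply_apply, hg, hginv,
        ballContraction_ballContractionInv hv16, smul_smul, mul_inv_cancel₀ (by norm_num : (16 : ℝ) ≠ 0),
        one_smul]
  -- `μ ∘ (R ∘ σ⁻¹ ∘ S₀ ∘ (2 •)) = Γ` on the ball of radius `4`
  have hflat : ∀ y : 𝔼 3, ‖y‖ < 4 →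
      μ (R (σ.symm (S₀ ((2 : ℝ) • y)))) = Φ₀.Γ y := by
    intro y hy
    simp only [hμ]
    rw [hRR, hσσ, LinearIsometryEquiv.symm_apply_apply, hg,
      ballContraction_eq_smul_of_norm_lt (by
        rw [norm_smul, Real.norm_eq_abs, abs_of_pos two_pos]; linarith), smul_smul, smul_smul]
    norm_num
  exact ⟨μ, μinv, fun a ↦ rfl, hμs, hμinvs, hopen, hleft, hK, hcov, hflat⟩

end Literature.Topology.FourManifolds
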